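import Literature.InformationTheory.QuantumCodes.CoprimeBivariateBicycle
import Literature.InformationTheory.QuantumCodes.Phi85Trinomials
import Mathlib.RingTheory.AdjoinRoot
import Mathlib.RingTheory.Polynomial.Cyclotomic.Roots
import Mathlib.Algebra.CharP.Algebra
import Mathlib.Algebra.CharP.Two
import Mathlib.Tactic.ComputeDegree
import HarnessLib

/-!
# Postema–Kokkelmans 2026: Lemma 3.3 and the proof step of Theorem 3.5 are false as printed (refutations)

Venture QEC (cell `qec`), item 02.PK26L33 (qec-type-02), FINDINGS watch row D-W2′ (erratum-vs-printed-theorem class).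
Statements: `CoprimeBivariateBicycle.lean` (`PK26_lemma33_asPrinted`, `PK26_thm35_proofStep_asPrinted`, typed by qec-lit-4).
ENGINE (no second engine, per qec-lit-3 02:39:04Z): `Phi85Trinomials.lean` (qec-lit-3, p488342) — in every field of
characteristic 2, no element `α` with `α⁵ = 1` or `α¹⁷ = 1` satisfies `1 + α^s + α^t = 0`, and every primitive 85-th root of
unity satisfies such a relation with `0 < s < t < 85`. This file is the THIN bridge from those field facts to the paper's
polynomial statements (irreducible factors of cyclotomic polynomials over `𝔽₂` and trinomials `1 + X^a + X^b`), via the field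
`AdjoinRoot f` of an irreducible `f` (`f ∣ t ↔ aeval (root f) t = 0`):

* `allMinimalPolynomialsDivideTrinomials_85`, `not_allMinimalPolynomialsDivideTrinomials_5`, `…_17`;
* **`not_PK26_lemma33_asPrinted`** (Lemma 3.3 as printed is false at `n = 85`);
* `not_isMersennePrime_5`, `not_isMersennePrime_17`; the explicit common factor `g₈ = phi85f8 = X⁸+X⁶+X⁵+X⁴+X³+X+1` of
  `a = 1 + X + X¹⁶`, `b = 1 + X⁴ + X⁶⁴` and `X⁸⁵ − 1` (qec-lit-3's exported divisibilities, p489153 — no second engine);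
* **`not_PK26_thm35_proofStep_asPrinted`** — the proof sentence of Thm 3.5 fails at `(ℓ, m) = (5, 17)`, `a = 1 + z + z¹⁶`,
  `b = 1 + z⁴ + z⁶⁴`: exactly the constructors of the census code of cell `(170, 16)`, whose length `170 = 2·5·17` has no Mersenne
  or outlier prime factor. The census-facing corollary under the paper's operative univariate ansatz (reading (U): a coprime BB
  code with `k = 16 ≥ 2` although clause (2) fails) uses `BB170k16.k_eq` (Summits-side) and therefore lives in
  `Summits/Ventures/QEC/Census/BB/BB170k16/CoprimeReading.lean` (Literature may not import Summits).

Scope note (qec-lit-3 02:13:41Z, qec-lit-4 READ-2 §3): Theorem 3.5 itself under the STRICT bivariate shape (2) is not refuted by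
this object (no `(5, 17)` code is in that shape); under the paper's operative univariate-trinomial ansatz (p. 9, Table 1) it is.
Everything here has standard axioms; nothing is evaluated by `decide`. [cite: PostemaKokkelmans2026, Lemma 3.3 p. 15 L13-15; Theorem 3.5 proof p. 16 L17-19]
-/

namespace Literature.InformationTheory.QuantumCodes

open Polynomial

namespace PK26

open Phi85Trinomials

/-! ### From an irreducible factor to a field with a root -/

/-- For an irreducible `f` over `𝔽₂`, the field `AdjoinRoot f` has characteristic `2`. [folklore] -/
private theorem charP_adjoinRoot {f : (ZMod 2)[X]} (hf : Irreducible f) :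
    haveI := Fact.mk hf; CharP (AdjoinRoot f) 2 := by
  haveI := Fact.mk hf
  exact charP_of_injective_algebraMap (algebraMap (ZMod 2) (AdjoinRoot f)).injective 2

/-- In `AdjoinRoot f`: `f ∣ t ↔ t(root f) = 0`. [folklore] -/
private theorem dvd_iff_aeval_root_eq_zero (f t : (ZMod 2)[X]) : f ∣ t ↔ aeval (AdjoinRoot.root f) t = 0 := by
  rw [AdjoinRoot.aeval_eq, AdjoinRoot.mk_eq_zero]

/-- A root of an irreducible factor of `Φ_n` over `𝔽₂` (odd `n`) is a primitive `n`-th root of unity in `AdjoinRoot f`. [folklore] -/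
private theorem isPrimitiveRoot_root {n : ℕ} (hn : Odd n) {f : (ZMod 2)[X]} (hf : Irreducible f)
    (hfd : f ∣ cyclotomic n (ZMod 2)) :
    haveI := Fact.mk hf; IsPrimitiveRoot (AdjoinRoot.root f) n := by
  haveI := Fact.mk hf
  haveI : CharP (AdjoinRoot f) 2 := charP_adjoinRoot hf
  haveI : NeZero ((n : ℕ) : AdjoinRoot f) := ⟨by
    rw [Ne, CharP.cast_eq_zero_iff (AdjoinRoot f) 2 n]
    exact hn.not_two_dvd_nat⟩
  rw [← isRoot_cyclotomic_iff, IsRoot.def, ← map_cyclotomic n (algebraMap (ZMod 2) (AdjoinRoot f)), eval_map_algebraMap]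
  exact (dvd_iff_aeval_root_eq_zero f _).1 hfd

/-! ### The three facts at `n = 85`, `5`, `17` -/

/-- **Every minimal polynomial of `Φ₈₅` over `𝔽₂` divides a trinomial** (from `trinomial_relation_of_primitive85`).
[cite: PostemaKokkelmans2026, Lemma 3.3 p. 15 L13-15 (left-hand side holds at n = 85)] -/
theorem allMinimalPolynomialsDivideTrinomials_85 : AllMinimalPolynomialsDivideTrinomials 85 := by
  intro f hf hfd
  haveI := Fact.mk hf
  haveI : CharP (AdjoinRoot f) 2 := charP_adjoinRoot hf
  have hprim := isPrimitiveRoot_root (by decide : Odd 85) hf hfd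
  obtain ⟨s, t, hs, hst, -, hrel⟩ := trinomial_relation_of_primitive85 (AdjoinRoot.root f) hprim.pow_eq_one
    (hprim.pow_ne_one_of_pos_of_lt (l := 5) (by norm_num) (by norm_num))
    (hprim.pow_ne_one_of_pos_of_lt (l := 17) (by norm_num) (by norm_num))
  refine ⟨1 + X ^ s + X ^ t, ⟨s, t, hs, hst, rfl⟩, (dvd_iff_aeval_root_eq_zero f _).2 ?_⟩
  simpa using hrel

/-- No minimal polynomial of `Φ_p` divides a trinomial when no `α` with `α^p = 1` satisfies a trinomial relation (`p` odd). [folklore] -/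
private theorem not_allMin_of_no_relation {p : ℕ} (hp : Odd p) (hp1 : 1 < p)
    (H : ∀ (K : Type) [Field K] [CharP K 2] (α : K), α ^ p = 1 → ∀ s t : ℕ, 1 + α ^ s + α ^ t ≠ 0) :
    ¬ AllMinimalPolynomialsDivideTrinomials p := by
  intro hall
  have hne : cyclotomic p (ZMod 2) ≠ 0 := cyclotomic_ne_zero p (ZMod 2)
  have hnu : ¬ IsUnit (cyclotomic p (ZMod 2)) := by
    refine fun hu => absurd (natDegree_eq_zero_of_isUnit hu) ?_
    rw [natDegree_cyclotomic]
    exact (Nat.totient_pos.2 (by omega)).ne'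
  obtain ⟨f, hf, hfd⟩ := WfDvdMonoid.exists_irreducible_factor hnu hne
  obtain ⟨t, ⟨a, b, -, -, rfl⟩, hft⟩ := hall f hf hfd
  haveI := Fact.mk hf
  haveI : CharP (AdjoinRoot f) 2 := charP_adjoinRoot hf
  have hprim := isPrimitiveRoot_root hp hf hfd
  have h0 := (dvd_iff_aeval_root_eq_zero f _).1 hft
  simp only [map_add, map_one, map_pow, aeval_X] at h0
  exact H (AdjoinRoot f) (AdjoinRoot.root f) hprim.pow_eq_one a b h0

/-- **No minimal polynomial of `Φ₅` over `𝔽₂` divides a trinomial** (5 is neither Mersenne nor an outlier).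
[cite: PostemaKokkelmans2026, Lemma 3.2 p. 15 L1-6] -/
theorem not_allMinimalPolynomialsDivideTrinomials_5 : ¬ AllMinimalPolynomialsDivideTrinomials 5 :=
  not_allMin_of_no_relation (by decide) (by norm_num) fun K _ _ α hα s t => no_trinomial_relation_of_pow5 α hα s t

/-- **No minimal polynomial of `Φ₁₇` over `𝔽₂` divides a trinomial** (17 is neither Mersenne nor an outlier).
[cite: PostemaKokkelmans2026, Lemma 3.2 p. 15 L1-6] -/
theorem not_allMinimalPolynomialsDivideTrinomials_17 : ¬ AllMinimalPolynomialsDivideTrinomials 17 :=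
  not_allMin_of_no_relation (by decide) (by norm_num) fun K _ _ α hα s t => no_trinomial_relation_of_pow17 α hα s t

/-- **Lemma 3.3 of Postema–Kokkelmans 2026 is false as printed** (at `n = 85 = 5 · 17`: every minimal polynomial of `Φ₈₅`
divides a trinomial, none of `Φ₅`, `Φ₁₇` does). [cite: PostemaKokkelmans2026, Lemma 3.3 p. 15 L13-15 (refuted: «only if» fails at n = 85)] -/
theorem not_PK26_lemma33_asPrinted : ¬ PK26_lemma33_asPrinted :=
  lemma33_false_shape allMinimalPolynomialsDivideTrinomials_85 not_allMinimalPolynomialsDivideTrinomials_5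
    not_allMinimalPolynomialsDivideTrinomials_17

/-! ### The explicit common factor at `(ℓ, m) = (5, 17)` (qec-lit-3's `phi85f8` and its exported divisibilities) -/

/-- `g₈ := phi85f8 = X⁸ + X⁶ + X⁵ + X⁴ + X³ + X + 1` divides `a(z) = 1 + z + z¹⁶` (lit-3's `phi85f8_dvd_trinomial`). [folklore] -/
private theorem phi85f8_dvd_a : phi85f8 ∣ (1 + X ^ 1 + X ^ 16 : (ZMod 2)[X]) := by
  have h : (1 + X ^ 1 + X ^ 16 : (ZMod 2)[X]) = X ^ 16 + X ^ 1 + 1 := by ring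
  rw [h]; exact phi85f8_dvd_trinomial

/-- `g₈` divides `b(z) = 1 + z⁴ + z⁶⁴` (lit-3's `phi85f8_dvd_pow4`). [folklore] -/
private theorem phi85f8_dvd_b : phi85f8 ∣ (1 + X ^ 4 + X ^ 64 : (ZMod 2)[X]) := by
  have h : (1 + X ^ 4 + X ^ 64 : (ZMod 2)[X]) = X ^ 64 + X ^ 4 + 1 := by ring
  rw [h]; exact phi85f8_dvd_pow4

/-- `g₈` divides `z⁸⁵ − 1` (lit-3's `phi85f8_dvd_X_pow_85_sub_one`). [folklore] -/
private theorem phi85f8_dvd_X_pow_5_mul_17_sub_one : phi85f8 ∣ (X ^ (5 * 17) - 1 : (ZMod 2)[X]) :=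
  phi85f8_dvd_X_pow_85_sub_one

/-- `deg g₈ = 8`. [folklore] -/
private theorem natDegree_phi85f8 : phi85f8.natDegree = 8 := by
  unfold phi85f8
  compute_degree!

/-! ### 5 and 17 are not Mersenne primes -/

/-- Powers of two are never `6` or `18`. [folklore] -/
private theorem two_pow_ne (s : ℕ) : 2 ^ s ≠ 6 ∧ 2 ^ s ≠ 18 := by
  rcases Nat.lt_or_ge s 5 with h | h
  · interval_cases s <;> norm_num
  · have : 2 ^ 5 ≤ 2 ^ s := Nat.pow_le_pow_right (by norm_num) h
    constructor <;> omega

/-- `5` is not of the form `2^s − 1`. [cite: PostemaKokkelmans2026, Lemma 3.2 p. 15 L3-4 (Mersenne primes)] -/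
theorem not_isMersennePrime_5 : ¬ IsMersennePrime 5 := by
  rintro ⟨-, s, hs⟩
  have h1 : 1 ≤ 2 ^ s := Nat.one_le_two_pow
  exact (two_pow_ne s).1 (by omega)

/-- `17` is not of the form `2^s − 1`. [cite: PostemaKokkelmans2026, Lemma 3.2 p. 15 L3-4 (Mersenne primes)] -/
theorem not_isMersennePrime_17 : ¬ IsMersennePrime 17 := by
  rintro ⟨-, s, hs⟩
  have h1 : 1 ≤ 2 ^ s := Nat.one_le_two_pow
  exact (two_pow_ne s).2 (by omega)

/-- **The proof step of Theorem 3.5 is false as printed**: at `(ℓ, m) = (5, 17)` the trinomials `a = 1 + z + z¹⁶`, `b = 1 + z⁴ + z⁶⁴`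
have the common factor `g₈` of positive degree with `z⁸⁵ − 1` (so `gcd(a, b, z⁸⁵ − 1)` is non-trivial — indeed the census code of
cell `(170,16)` built from them has `k = 2 · 8 = 16`, `BB170k16.k_eq`), while `85 = 5 · 17` has no Mersenne prime factor and no
outlier prime factor. [cite: PostemaKokkelmans2026, Theorem 3.5 proof p. 16 L17-19 (refuted at ℓm = 85)] -/
theorem not_PK26_thm35_proofStep_asPrinted : ¬ PK26_thm35_proofStep_asPrinted :=
  thm35_proofStep_false_shape (a := 1 + X ^ 1 + X ^ 16) (b := 1 + X ^ 4 + X ^ 64) (g := phi85f8)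
    ⟨1, 16, by norm_num, by norm_num, rfl⟩ ⟨4, 64, by norm_num, by norm_num, rfl⟩ (by rw [natDegree_phi85f8]; norm_num)
    phi85f8_dvd_a phi85f8_dvd_b phi85f8_dvd_X_pow_5_mul_17_sub_one not_isMersennePrime_5 not_isMersennePrime_17
    not_allMinimalPolynomialsDivideTrinomials_5 not_allMinimalPolynomialsDivideTrinomials_17

/-- `ℓm = 85 = 5 · 17` has no Mersenne prime factor and no outlier prime factor (condition (2) of the coprime clause of Thm 3.5
fails for every code of length `170`). [cite: PostemaKokkelmans2026, Theorem 3.5 p. 16 L2-8 (condition (2)) and Lemma 3.2 p. 15 L1-6] -/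
theorem no_mersenne_or_outlier_prime_dvd_85 : ¬ ∃ p : ℕ, p ∣ 5 * 17 ∧ (IsMersennePrime p ∨ IsOutlierPrime p) := by
  rintro ⟨p, hpd, hp⟩
  have hprime : p.Prime := by
    rcases hp with hp | hp
    · exact hp.1
    · exact hp.1
  rw [hprime.dvd_mul] at hpd
  rcases hpd with hd | hd
  · have := (Nat.prime_dvd_prime_iff_eq hprime (by decide)).mp hd
    subst this
    rcases hp with hp | hp
    · exact not_isMersennePrime_5 hp
    · exact not_allMinimalPolynomialsDivideTrinomials_5 hp.2.2
  · have := (Nat.prime_dvd_prime_iff_eq hprime (by decide)).mp hd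
    subst this
    rcases hp with hp | hp
    · exact not_isMersennePrime_17 hp
    · exact not_allMinimalPolynomialsDivideTrinomials_17 hp.2.2

end PK26

end Literature.InformationTheory.QuantumCodes
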